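import Literature.MathematicalPhysics.QuantumFieldTheory.Balaban1983to89.Node00.Carriers2
import Literature.MathematicalPhysics.QuantumFieldTheory.Balaban1983to89.Node00.CarriersFrame

/-!
# NODE 00 (YM-PLAN Track A) — STAGE-2 FRAME: the leaves over `carriers₂ θ X` (B4, B5 AND B7 pinned) and the carrier-only DAG nodes at a
# world of record, Stage 2, UNFOLDED to the printed leaves of the run's free carriers

NODE 00 STAGE-2 COMPANION MODULE (seat `pub-ymgap-node00-def`; CONVENTIONS OF RECORD of `Node00Carriers`; the Stage-1 twin is
`Node00CarriersFrame`).  APPEND-ONLY GROWTH (P8″ (ii)).  Every statement is `rfl`-bookkeeping or a one-line consequence of the three Stage-2 leaves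
`carriers₁_b4 ∕ carriers₁_b5 ∕ carriers₂_b7`; NOTHING of Bałaban's is asserted; no node is discharged here.  One finite T⁴ programme at fixed ε; NOT
ℝ⁴ ∕ infinite volume ∕ OS ∕ mass gap ∕ Clay.

WHAT THIS FILE RECORDS (0 sorry; axioms standard):
* `leaves_carriers₂_pinned` — `b7` over `carriers₂ θ X` IS `B7.Concl L (cB D L) (C0 D) (c2' D L) (concreteOneStepBD 𝔸 L) … (concreteGaugeOneStep 𝔸 L)`
  ([Balaban1985Averaging] Props. 1–10 at the lineage's concrete `ℤᵈ` carriers), and `b4`, `b5` are those over `carriers₁` (the inner B7 substitution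
  does not touch them);
* `leaves_carriers₂_free` — `b6`, `b8 … b13`, `rOperation`, `rBasicStep` are literally the leaves over the un-substituted bundles;
* node level at a run with `w.up P = ofPrintedAllXPN (carriers₂ θ X) Y Z V W` (admissible `θ`): N01 N02 N04 hold (`Node00Carriers2`); N03 is NOT
  restated here (gate `dedup.landed`): `CarriersFrame.b6_main_iff_of_up` applies VERBATIM at `θ.toStage1Params` and `X′ := withB7OfRecord X θ.D θ.L θ.𝔸`
  (`carriers₂ θ X` unfolds to `carriers₁ θ.toStage1Params X′` and `X′.D6` to `X.D6` by `rfl`), giving `Dag.B6_main (leavesP w P) ↔ B6BlockParam X.D6`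
  (N03 waits for the multi-level block); `b9_main_iff_of_up₂ : Dag.B9_main … ↔ (b6 → B9LeafX Y)`; `b8_ ∕ b11_ ∕ b10_ ∕ b15_main_iff_of_up₂` likewise
  with `b7` discharged — the Stage-2 row of the in-edge vacuity map.
-/

noncomputable section

namespace Literature.MathematicalPhysics.QuantumFieldTheory.Balaban1983to89.Node00

open scoped Matrix
open DagBinding DagDischargedII B4GaugeCovariance
open B7Prop2Explicit (C0 c2' concreteKStep unitaryUnits)
open B7ConclOneStep (concreteOneStepBD)
open B7ConclKExp (concreteKExp)
open B7ConclGauge (cB concreteGaugeData concreteGaugeOneStep)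

variable (θ : Stage2Params) (X : PrintedCarriersR) (Y : PrintedCarriers9X) (Z : PrintedCarriers11) (V : PrintedCarriers14R)
  (W : PrintedCarriers15)

/-- **The PINNED `b7` leaf over `carriers₂ θ X` is `B7.Concl` at the lineage's concrete carriers** (`rfl`), and `b4`, `b5` are the Stage-1 pinned leaves
over `carriers₁ θ.toStage1Params X′` with `X′ := withB7OfRecord X D L 𝔸` (whose B4 ∕ B5 groups are again the lineage families — `leaves_carriers₁_pinned`).
[cite: Balaban1985Averaging, Props. 1–10 pp.26–50; Balaban1983RegularityDecay, Theorem p.573; Balaban1984PropagatorsI, Props. 1.1–1.2 pp.33–36 (dictionary, bookkeeping)] -/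
theorem leaves_carriers₂_pinned :
    (Upstream.ofPrintedAllXPN (carriers₂ θ X) Y Z V W).b7 =
      B7.Concl (θ.L : ℝ) (cB θ.D θ.L) (C0 θ.D) (c2' θ.D θ.L)
        (concreteOneStepBD θ.𝔸 (d := θ.D) θ.L)
        (fun k : ℕ => concreteKStep θ.D θ.𝔸 (unitaryUnits θ.𝔸) θ.L k)
        (concreteKExp θ.𝔸 (unitaryUnits θ.𝔸) (d := θ.D) θ.L)
        (concreteGaugeData θ.𝔸 (d := θ.D) θ.L)
        (concreteGaugeOneStep θ.𝔸 (d := θ.D) θ.L) ∧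
    (Upstream.ofPrintedAllXPN (carriers₂ θ X) Y Z V W).b4 =
      (Upstream.ofPrintedAllXPN (carriers₁ θ.toStage1Params (withB7OfRecord X θ.D θ.L θ.𝔸)) Y Z V W).b4 ∧
    (Upstream.ofPrintedAllXPN (carriers₂ θ X) Y Z V W).b5 =
      (Upstream.ofPrintedAllXPN (carriers₁ θ.toStage1Params (withB7OfRecord X θ.D θ.L θ.𝔸)) Y Z V W).b5 :=
  ⟨rfl, rfl, rfl⟩

/-- **Every OTHER leaf over `carriers₂ θ X` is literally the leaf over the un-substituted bundles** (`rfl`): `b6`, `b8 … b13`, `rOperation`,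
`rBasicStep`. [cite: Balaban1984PropagatorsII, Lemma 2.1 p.234; Balaban1985RegularSpaces, Thm 8 p.101 (dictionary, bookkeeping: the un-pinned leaves)] -/
theorem leaves_carriers₂_free :
    (Upstream.ofPrintedAllXPN (carriers₂ θ X) Y Z V W).b6 = (Upstream.ofPrintedAllXPN X Y Z V W).b6 ∧
    (Upstream.ofPrintedAllXPN (carriers₂ θ X) Y Z V W).b8 = (Upstream.ofPrintedAllXPN X Y Z V W).b8 ∧
    (Upstream.ofPrintedAllXPN (carriers₂ θ X) Y Z V W).b9 = (Upstream.ofPrintedAllXPN X Y Z V W).b9 ∧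
    (Upstream.ofPrintedAllXPN (carriers₂ θ X) Y Z V W).b10 = (Upstream.ofPrintedAllXPN X Y Z V W).b10 ∧
    (Upstream.ofPrintedAllXPN (carriers₂ θ X) Y Z V W).b11 = (Upstream.ofPrintedAllXPN X Y Z V W).b11 ∧
    (Upstream.ofPrintedAllXPN (carriers₂ θ X) Y Z V W).b12 = (Upstream.ofPrintedAllXPN X Y Z V W).b12 ∧
    (Upstream.ofPrintedAllXPN (carriers₂ θ X) Y Z V W).b13 = (Upstream.ofPrintedAllXPN X Y Z V W).b13 ∧
    (Upstream.ofPrintedAllXPN (carriers₂ θ X) Y Z V W).rOperation = (Upstream.ofPrintedAllXPN X Y Z V W).rOperation ∧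
    (Upstream.ofPrintedAllXPN (carriers₂ θ X) Y Z V W).rBasicStep = (Upstream.ofPrintedAllXPN X Y Z V W).rBasicStep :=
  ⟨rfl, rfl, rfl, rfl, rfl, rfl, rfl, rfl, rfl⟩

section Nodes

variable {θ X Y Z V W} (hθ : θ.toStage1Params.Admissible) {w : WorldP} {P : B12.RunParams}
  (hP : w.up P = Upstream.ofPrintedAllXPN (carriers₂ θ X) Y Z V W)

-- N03 (`Dag.B6_main (leavesP w P) ↔ B6BlockParam X.D6`) at a Stage-2 run: use `CarriersFrame.b6_main_iff_of_up` at `θ.toStage1Params`,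
-- `withB7OfRecord X θ.D θ.L θ.𝔸` (see the module docstring) — not restated (gate dedup).

include hθ hP in
/-- **N06 at a Stage-2 run**: with `b4`, `b5`, `b7` discharged, `Dag.B9_main (leavesP w P) ↔ (b6 → B9LeafX Y)` over the run's FREE carriers `X.D6`, `Y`.
[cite: Balaban1985BackgroundPropagators, Thms 3.1–3.15 pp.397–432 (dictionary, bookkeeping)] -/
theorem b9_main_iff_of_up₂ :
    Dag.B9_main (leavesP w P) ↔
      ((Upstream.ofPrintedAllXPN X Y Z V W).b6 → (Upstream.ofPrintedAllXPN X Y Z V W).b9) := by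
  show ((w.up P).b4 → (w.up P).b5 → (w.up P).b6 → (w.up P).b7 → (w.up P).b9) ↔ _
  rw [hP]
  exact ⟨fun h h6 => h (carriers₁_b4 _ hθ _ Y Z V W) (carriers₁_b5 _ hθ _ Y Z V W) h6 (carriers₂_b7 θ X Y Z V W),
    fun h _ _ h6 _ => h h6⟩

include hθ hP in
/-- **N05 at a Stage-2 run**: `Dag.B8_main (leavesP w P) ↔ (b6 → b9 → b8)` over the run's FREE carriers (`b5`, `b7` discharged).
[cite: Balaban1985RegularSpaces, Thm 2 p.83, Thm 4 p.88, Thm 8 p.101 (dictionary, bookkeeping)] -/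
theorem b8_main_iff_of_up₂ :
    Dag.B8_main (leavesP w P) ↔
      ((Upstream.ofPrintedAllXPN X Y Z V W).b6 → (Upstream.ofPrintedAllXPN X Y Z V W).b9 →
        (Upstream.ofPrintedAllXPN X Y Z V W).b8) := by
  show ((w.up P).b5 → (w.up P).b6 → (w.up P).b7 → (w.up P).b9 → (w.up P).b8) ↔ _
  rw [hP]
  exact ⟨fun h h6 => h (carriers₁_b5 _ hθ _ Y Z V W) h6 (carriers₂_b7 θ X Y Z V W), fun h _ h6 _ => h h6⟩

include hθ hP in
/-- **N07 at a Stage-2 run**: `Dag.B11_main (leavesP w P) ↔ (b6 → b8 → b9 → b11)` over the run's FREE carriers (`b5`, `b7` discharged).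
[cite: Balaban1985Variational, Thm 1 p.279, Props. 2–9 pp.281–309 (dictionary, bookkeeping)] -/
theorem b11_main_iff_of_up₂ :
    Dag.B11_main (leavesP w P) ↔
      ((Upstream.ofPrintedAllXPN X Y Z V W).b6 → (Upstream.ofPrintedAllXPN X Y Z V W).b8 →
        (Upstream.ofPrintedAllXPN X Y Z V W).b9 → (Upstream.ofPrintedAllXPN X Y Z V W).b11) := by
  show ((w.up P).b5 → (w.up P).b6 → (w.up P).b7 → (w.up P).b8 → (w.up P).b9 → (w.up P).b11) ↔ _
  rw [hP]
  exact ⟨fun h h6 => h (carriers₁_b5 _ hθ _ Y Z V W) h6 (carriers₂_b7 θ X Y Z V W), fun h _ h6 _ => h h6⟩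

include hθ hP in
/-- **N08 at a Stage-2 run**: `Dag.B10_main (leavesP w P) ↔ (b6 → b8 → b9 → b11 → b10)` over the run's FREE carriers (`b5`, `b7` discharged; the
carver's Q2 on the b10 leaf of record is open). [cite: Balaban1985UV3, Thm 1 p.257, Thm 2 p.272 (dictionary, bookkeeping)] -/
theorem b10_main_iff_of_up₂ :
    Dag.B10_main (leavesP w P) ↔
      ((Upstream.ofPrintedAllXPN X Y Z V W).b6 → (Upstream.ofPrintedAllXPN X Y Z V W).b8 →
        (Upstream.ofPrintedAllXPN X Y Z V W).b9 → (Upstream.ofPrintedAllXPN X Y Z V W).b11 →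
          (Upstream.ofPrintedAllXPN X Y Z V W).b10) := by
  show ((w.up P).b5 → (w.up P).b6 → (w.up P).b7 → (w.up P).b8 → (w.up P).b9 → (w.up P).b11 → (w.up P).b10) ↔ _
  rw [hP]
  exact ⟨fun h h6 => h (carriers₁_b5 _ hθ _ Y Z V W) h6 (carriers₂_b7 θ X Y Z V W), fun h _ h6 _ => h h6⟩

include hθ hP in
/-- **N12 at a Stage-2 run**: `Dag.B15_main (leavesP w P) ↔ (b8 → b10 → b11 → B15Leaf W)` over the run's FREE carriers (`b5`, `b7` discharged).
[cite: Balaban1989LargeFieldI, Prop. 1 p.194 (dictionary, bookkeeping)] -/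
theorem b15_main_iff_of_up₂ :
    Dag.B15_main (leavesP w P) ↔
      ((Upstream.ofPrintedAllXPN X Y Z V W).b8 → (Upstream.ofPrintedAllXPN X Y Z V W).b10 →
        (Upstream.ofPrintedAllXPN X Y Z V W).b11 → (Upstream.ofPrintedAllXPN X Y Z V W).rBasicStep) := by
  show ((w.up P).b5 → (w.up P).b7 → (w.up P).b8 → (w.up P).b10 → (w.up P).b11 → (w.up P).rBasicStep) ↔ _
  rw [hP]
  exact ⟨fun h => h (carriers₁_b5 _ hθ _ Y Z V W) (carriers₂_b7 θ X Y Z V W), fun h _ _ => h⟩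

end Nodes

end Literature.MathematicalPhysics.QuantumFieldTheory.Balaban1983to89.Node00

end
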